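import Summits.HodgeConjecture.CorCM.GaloisNonNormalPrimeOrder
import Summits.HodgeConjecture.CorCM.GaloisDegenerateMonotone
import HarnessLib

/-!
# A NON-CENTRAL INVOLUTION IN A CM QUOTIENT makes the field BAD (the involution criterion modulo a normal subgroup)

COR-CM (cell `pub-hodgecm2`), binder seat b04 (gen 34), count-neutral own lane «Galois-CM-type classification».  KERNEL ONLY:
theorems; no definition, no named fact, no `sorry`.  `HC_CM` is neither used nor claimed.  Gen 33's criterion «a non-central
involution of `Gal(K/ℚ)` and `[K:ℚ] ≥ 52` ⟹ BAD» (`GaloisModels.exists_simple_degenerate_of_noncentral_involution_of_card_ge`) is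
transported to every CM QUOTIENT `Gal(K/ℚ)/N` (`N ◁ Gal(K/ℚ)`, complex conjugation `∉ N`, `[Gal:N] ≥ 52`) WITHOUT identifying the
quotient group: it suffices to exhibit `y, g ∈ Gal(K/ℚ)` with `y² ∈ N` and `g y ≢ y g (mod N)`.  The restriction
`ρ : Gal(K/ℚ) → Gal(K/ℚ)/N ≃ Gal(K^N/ℚ)` (Mathlib's `IsGalois.normalAutEquivQuotient`) makes `ρ y` a non-central involution of `Gal(K^N/ℚ)`, `K^N` is a Galois CM field of degree `[Gal:N]`
(`GaloisRank.isCMField_fixedField_of_not_mem`), so `K^N` is BAD, and BAD ascends to `K` by gen 32's monotonicity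
(`GaloisModels.exists_simple_degenerate_of_fixedField_of_ne_bot`).  This turns the hand arguments «the quotient `G/⟨t⟩` is dihedral /
semidihedral / modular, hence has a non-central involution» of the `2`-group classification (A7-JUNCTION gen-34 §C) into one-line
kernel facts: no quotient isomorphism is needed, only two elements and two membership checks.

* `exists_simple_degenerate_of_noncentral_involution_mod` — `N ◁ Gal(K/ℚ)`, `c ∉ N`, `N ≠ 1`, `52 ≤ [Gal:N]`, `y² ∈ N`,
  `(g y)(y g)⁻¹ ∉ N` ⟹ `K` carries a SIMPLE DEGENERATE abelian variety of dimension `[K:ℚ]/2` (an exceptional Hodge class on a power).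
* `mul_comm_mod_of_forall_isNondegenerate` — contrapositive: in a GOOD field, involutions of every such CM quotient are central.
* `exists_simple_degenerate_of_noncentral_involution_mod_central` — MODEL form with `N = ⟨t⟩`, `t` a central involution of the
  model `G₀ ≅ Gal(K/ℚ)` different from `c`, `|G₀| ≥ 104`: `y² ∈ {1, t}` and `(g y)(y g)⁻¹ ∉ {1, t}` ⟹ BAD.  Example rows (gen-34
  §C): `(C_{2^a} ⋊₋₁ C₄, c = α)` via `t = x²`, `y = x`, `g` the generator (`(g x)(x g)⁻¹ = g²`); `C₄ ⋊ C_{2^a}` via `t = x² c`; the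
  semidihedral / modular quotients of the index-two overgroups of `C_{2^a} × C₂`.

## References

* [Shimura1998] G. Shimura, *Abelian Varieties with Complex Multiplication and Modular Functions*, §6.2 Thm. 3, §8.2 Prop. 26, §32.10.
* [Kubota1965] T. Kubota, *On the field extension by complex multiplication*, Trans. AMS 118 (1965), §2 and §4 Lemma 2.
* [Gordon1999HodgeAVSurvey] B. B. Gordon, *A survey of the Hodge conjecture for abelian varieties*, Thm. 6.4, §9.3.
-/

noncomputable section

open CategoryTheory CategoryTheory.Limits NumberField
open scoped BigOperators

namespace Summit.HodgeConjecture.CorCM.GaloisModels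

open Literature.NumberTheory.ComplexMultiplication
open Literature.AlgebraicGeometry.Motives (AbelianVariety CMType)
open Literature.AlgebraicGeometry.HodgeTheory
open Literature.AlgebraicGeometry.ComplexMultiplication (IsCMTypeRealisation)
open Literature.AlgebraicGeometry.Pohlmann1968
open Literature.Barriers.HodgeConjecture (divisorClassesSpan)
open Summit.HodgeConjecture.CorCM.GaloisRank

variable {K : Type} [Field K] [NumberField K] [IsCMField K] [IsGalois ℚ K]

/-! ## §1 The criterion modulo a normal subgroup -/

omit [IsCMField K] in
/-- The degree of the fixed field of `N` over `ℚ` is the index of `N`. [folklore] -/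
theorem finrank_fixedField_eq_index (N : Subgroup (K ≃ₐ[ℚ] K)) :
    Module.finrank ℚ (IntermediateField.fixedField N) = N.index := by
  classical
  have h1 := Module.finrank_mul_finrank ℚ (IntermediateField.fixedField N) K
  rw [IntermediateField.finrank_fixedField_eq_card, ← IsGalois.card_aut_eq_finrank ℚ K, ← N.index_mul_card,
    mul_comm N.index] at h1
  exact Nat.eq_of_mul_eq_mul_right Nat.card_pos (h1.trans (mul_comm _ _))

/-- **A NON-CENTRAL INVOLUTION IN A CM QUOTIENT ⟹ BAD.**  `N ◁ Gal(K/ℚ)` with complex conjugation `∉ N`, `N ≠ 1`, `[Gal:N] ≥ 52`;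
if `y² ∈ N` and `(g y)(y g)⁻¹ ∉ N` for some `y, g` (so `y mod N` is a non-central involution of `Gal(K^N/ℚ) = Gal/N`), then `K`
carries a SIMPLE DEGENERATE abelian variety of dimension `[K:ℚ]/2` with a rational `(p,p)` class outside the divisor ring on some
power. [cite: Shimura1998, §6.2 Thm. 3, §8.2 Prop. 26 and §32.10] [cite: Kubota1965, §2 and §4 Lemma 2]
[cite: Gordon1999HodgeAVSurvey, Thm. 6.4 and §9.3] -/
theorem exists_simple_degenerate_of_noncentral_involution_mod (N : Subgroup (K ≃ₐ[ℚ] K)) [N.Normal]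
    (hc : (IsCMField.complexConj K).restrictScalars ℚ ∉ N) (hN : N ≠ ⊥) (hidx : 52 ≤ N.index)
    (y g : K ≃ₐ[ℚ] K) (hyy : y * y ∈ N) (hyg : (g * y) * (y * g)⁻¹ ∉ N) :
    ∃ (Φ : CMType K) (φ : K →+* ℂ) (X : AbelianVariety ℂ) (ι : 𝓞 K →+* End X)
      (ϑ : K →+* Module.End ℂ (complexBetti X.X 1)),
      IsPrimitive (ℂ ≃+* ℂ) Φ.1 φ ∧ ¬ IsNondegenerate Φ ∧ IsCMTypeRealisation Φ X ι ϑ ∧ X.IsSimple ∧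
      X.dim = Module.finrank ℚ K / 2 ∧
      ∃ m p : ℕ, ∃ z : complexBetti (⨁ fun _ : Fin m => X).X (2 * p), IsRationalClass z ∧
        IsOfHodgeType (⨁ fun _ : Fin m => X).dim (⨁ fun _ : Fin m => X).X (2 * p) p p z ∧
        z ∉ divisorClassesSpan (⨁ fun _ : Fin m => X).X (⨁ fun _ : Fin m => X).dim p := by
  classical
  haveI : IsCMField (IntermediateField.fixedField N) := isCMField_fixedField_of_not_mem N hc
  haveI : IsGalois ℚ (IntermediateField.fixedField N) := IsGalois.of_fixedField_normal_subgroup N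
  -- `Gal(K/ℚ)/N ≃ Gal(K^N/ℚ)` (restriction), composed with the quotient map
  set π := QuotientGroup.mk' N with hπ
  set E := IsGalois.normalAutEquivQuotient (K := ℚ) (L := K) N with hE
  have hker : ∀ σ : K ≃ₐ[ℚ] K, E (π σ) = 1 ↔ σ ∈ N := fun σ => by
    rw [E.map_eq_one_iff, hπ, QuotientGroup.mk'_apply, QuotientGroup.eq_one_iff]
  have huu : E (π y) * E (π y) = 1 := by rw [← map_mul, ← map_mul, (hker _).2 hyy]
  have hnc : ∃ γ, γ * E (π y) ≠ E (π y) * γ := by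
    refine ⟨E (π g), fun h => hyg ((hker _).1 ?_)⟩
    simp only [map_mul, map_inv]
    rw [h, mul_inv_cancel]
  have hbig : 52 ≤ Fintype.card (IntermediateField.fixedField N ≃ₐ[ℚ] IntermediateField.fixedField N) := by
    rw [card_model_eq_finrank (MulEquiv.refl _), finrank_fixedField_eq_index N]
    exact hidx
  obtain ⟨Φ₀, φ₀, A, ι, θ, hprim, hndg, -⟩ :=
    exists_simple_degenerate_of_noncentral_involution_of_card_ge (MulEquiv.refl _) (E (π y)) huu hnc hbig
  exact exists_simple_degenerate_of_fixedField_of_ne_bot N hc hN Φ₀ φ₀ hprim hndg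

/-- **In a GOOD Galois CM field, every involution of every CM quotient of order `≥ 52` is central**: `N ◁ Gal(K/ℚ)`, `c ∉ N`,
`N ≠ 1`, `[Gal:N] ≥ 52`, `y² ∈ N` ⟹ `g y ≡ y g (mod N)` for all `g`. [cite: Shimura1998, §8.2 Prop. 26 and §32.10] -/
theorem mul_comm_mod_of_forall_isNondegenerate (N : Subgroup (K ≃ₐ[ℚ] K)) [N.Normal]
    (hc : (IsCMField.complexConj K).restrictScalars ℚ ∉ N) (hN : N ≠ ⊥) (hidx : 52 ≤ N.index)
    (hgood : ∀ (Φ : CMType K) (φ : K →+* ℂ), IsPrimitive (ℂ ≃+* ℂ) Φ.1 φ → IsNondegenerate Φ)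
    (y g : K ≃ₐ[ℚ] K) (hyy : y * y ∈ N) : (g * y) * (y * g)⁻¹ ∈ N := by
  by_contra hyg
  obtain ⟨Φ, φ, X, ι, ϑ, H1, H2, -⟩ := exists_simple_degenerate_of_noncentral_involution_mod N hc hN hidx y g hyy hyg
  exact H2 (hgood Φ φ H1)

/-! ## §2 Model form: modulo a central involution `t ≠ c` -/

/-- **MODULO A CENTRAL INVOLUTION.**  `e : Gal(K/ℚ) ≃* G₀`, `t ∈ G₀` a CENTRAL involution different from complex conjugation `c`,
`|G₀| ≥ 104`; if `y² ∈ {1, t}` and `(g y)(y g)⁻¹ ∉ {1, t}` for some `y, g ∈ G₀`, then `K` carries a SIMPLE DEGENERATE abelian variety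
of dimension `[K:ℚ]/2` (the CM quotient `G₀/⟨t⟩`, of order `≥ 52`, has the non-central involution `y ⟨t⟩`).
[cite: Shimura1998, §6.2 Thm. 3, §8.2 Prop. 26 and §32.10] [cite: Kubota1965, §2 and §4 Lemma 2]
[cite: Gordon1999HodgeAVSurvey, Thm. 6.4 and §9.3] -/
theorem exists_simple_degenerate_of_noncentral_involution_mod_central {G₀ : Type*} [Group G₀] [Fintype G₀]
    (e : (K ≃ₐ[ℚ] K) ≃* G₀) (t : G₀) (htt : t * t = 1) (ht1 : t ≠ 1) (htcen : ∀ g : G₀, t * g = g * t)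
    (htc : e ((IsCMField.complexConj K).restrictScalars ℚ) ≠ t) (hbig : 104 ≤ Fintype.card G₀)
    (y g : G₀) (hyy : y * y = 1 ∨ y * y = t) (hyg1 : (g * y) * (y * g)⁻¹ ≠ 1) (hygt : (g * y) * (y * g)⁻¹ ≠ t) :
    ∃ (Φ : CMType K) (φ : K →+* ℂ) (X : AbelianVariety ℂ) (ι : 𝓞 K →+* End X)
      (ϑ : K →+* Module.End ℂ (complexBetti X.X 1)),
      IsPrimitive (ℂ ≃+* ℂ) Φ.1 φ ∧ ¬ IsNondegenerate Φ ∧ IsCMTypeRealisation Φ X ι ϑ ∧ X.IsSimple ∧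
      X.dim = Module.finrank ℚ K / 2 ∧
      ∃ m p : ℕ, ∃ z : complexBetti (⨁ fun _ : Fin m => X).X (2 * p), IsRationalClass z ∧
        IsOfHodgeType (⨁ fun _ : Fin m => X).dim (⨁ fun _ : Fin m => X).X (2 * p) p p z ∧
        z ∉ divisorClassesSpan (⨁ fun _ : Fin m => X).X (⨁ fun _ : Fin m => X).dim p := by
  classical
  -- the subgroup `N = e⁻¹ ⟨t⟩ = {1, e⁻¹ t}`
  set s := e.symm t with hs
  have hss : s * s = 1 := by rw [hs, ← map_mul, htt, map_one]
  have hs1 : s ≠ 1 := fun h => ht1 (by rw [← e.apply_symm_apply t, ← hs, h, map_one])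
  have hscen : ∀ σ : K ≃ₐ[ℚ] K, σ * s = s * σ := fun σ => by
    apply e.injective
    rw [map_mul, map_mul, hs, e.apply_symm_apply, htcen]
  set N := Subgroup.zpowers s with hN
  -- membership in `N`: `σ ∈ N ↔ e σ ∈ {1, t}`
  have hmemN : ∀ σ : K ≃ₐ[ℚ] K, σ ∈ N ↔ (e σ = 1 ∨ e σ = t) := by
    intro σ
    rw [hN, Subgroup.mem_zpowers_iff]
    constructor
    · rintro ⟨i, rfl⟩
      obtain ⟨j, hj | hj⟩ := Int.even_or_odd' i
      · left
        rw [hj, zpow_mul, zpow_two, hss, one_zpow, map_one]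
      · right
        rw [hj, zpow_add, zpow_mul, zpow_two, hss, one_zpow, one_mul, zpow_one, hs, e.apply_symm_apply]
    · rintro (h | h)
      · exact ⟨0, by rw [zpow_zero]; exact (e.map_eq_one_iff.1 h).symm⟩
      · exact ⟨1, by rw [zpow_one, hs, ← h, e.symm_apply_apply]⟩
  haveI : N.Normal := by
    refine ⟨fun x hx σ => ?_⟩
    rw [hN, Subgroup.mem_zpowers_iff] at hx
    obtain ⟨i, rfl⟩ := hx
    rw [((show Commute σ s from hscen σ).zpow_right i).eq, mul_inv_cancel_right]
    exact Subgroup.zpow_mem _ (Subgroup.mem_zpowers s) i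
  have hc : (IsCMField.complexConj K).restrictScalars ℚ ∉ N := by
    rw [hmemN]
    rintro (h | h)
    · exact model_complexConj_ne_one e rfl h
    · exact htc h
  have hNbot : N ≠ ⊥ := fun h => hs1 (by
    have : s ∈ N := Subgroup.mem_zpowers s
    rw [h] at this
    exact Subgroup.mem_bot.1 this)
  have hNcard : Nat.card N = 2 := by
    rw [hN, Nat.card_zpowers]
    exact orderOf_eq_prime (by rw [pow_two, hss]) hs1
  have hidx : 52 ≤ N.index := by
    have h1 := N.index_mul_card
    rw [hNcard, Nat.card_eq_fintype_card, card_model_eq_finrank (MulEquiv.refl (K ≃ₐ[ℚ] K)),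
      ← card_model_eq_finrank e] at h1
    omega
  refine exists_simple_degenerate_of_noncentral_involution_mod N hc hNbot hidx (e.symm y) (e.symm g) ?_ ?_
  · rw [hmemN, ← map_mul, e.apply_symm_apply]
    exact hyy
  · rw [hmemN, not_or]
    simp only [map_mul, map_inv, e.apply_symm_apply]
    exact ⟨hyg1, hygt⟩

/-- **GOOD ⟹ involutions modulo a central involution are central** (model form, contrapositive): `t` a central involution of
`G₀ ≅ Gal(K/ℚ)` other than `c`, `|G₀| ≥ 104`, every primitive CM type of `K` nondegenerate, `y² ∈ {1, t}` ⟹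
`(g y)(y g)⁻¹ ∈ {1, t}` for every `g`. [cite: Shimura1998, §8.2 Prop. 26 and §32.10] -/
theorem mul_comm_mod_central_of_forall_isNondegenerate {G₀ : Type*} [Group G₀] [Fintype G₀]
    (e : (K ≃ₐ[ℚ] K) ≃* G₀) (t : G₀) (htt : t * t = 1) (ht1 : t ≠ 1) (htcen : ∀ g : G₀, t * g = g * t)
    (htc : e ((IsCMField.complexConj K).restrictScalars ℚ) ≠ t) (hbig : 104 ≤ Fintype.card G₀)
    (hgood : ∀ (Φ : CMType K) (φ : K →+* ℂ), IsPrimitive (ℂ ≃+* ℂ) Φ.1 φ → IsNondegenerate Φ)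
    (y g : G₀) (hyy : y * y = 1 ∨ y * y = t) : (g * y) * (y * g)⁻¹ = 1 ∨ (g * y) * (y * g)⁻¹ = t := by
  by_contra h
  rw [not_or] at h
  obtain ⟨Φ, φ, X, ι, ϑ, H1, H2, -⟩ :=
    exists_simple_degenerate_of_noncentral_involution_mod_central e t htt ht1 htcen htc hbig y g hyy h.1 h.2
  exact H2 (hgood Φ φ H1)

end Summit.HodgeConjecture.CorCM.GaloisModels
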